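import Mathlib
import Summits.Ventures.PercRepro2.Defs
import Summits.Ventures.PercRepro2.Independence
import Summits.Ventures.PercRepro2.Harris
import Summits.Ventures.PercRepro2.Graph
import Summits.Ventures.PercRepro2.Events
import Summits.Ventures.PercRepro2.Induced
import Summits.Ventures.PercRepro2.BHK
import Summits.Ventures.PercRepro2.BHKEvents
import Summits.Ventures.PercRepro2.BHKMixed
import Summits.Ventures.PercRepro2.OneEdge
import Summits.Ventures.PercRepro2.RBRootEdge

/-!
# Row 2′RB: removing a marker edge at the third vertex, I — the forced events and the brackets
(mine-a g6; MINE-A.md §39; proofs/MINEA-MARKEREDGE.md §2 (iv)–(v), §3)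

For an edge `g = {w, b}` between the third vertex `w` and the marker `b`, the events of the law
`p[g ↦ 1]` (the graph `G/g`) read on the law `p[g ↦ 0]` (the graph `G − g`) by forcing `g` open
(`OneEdge.conn_update_true_iff`): with `A = {s ↔ {b, w}}`, `D = {t ↮ {b, w}}`,
`Q⁺ ∩ bL⁺ = Q ∩ A ∩ D`, `Q⁺ ∩ (bL⁺)ᶜ = Q ∩ Aᶜ`, on the latter `oL⁺ = oL` and `oH⁺ ⊇ oH`, on the
former `oL⁺ ⊇ oL` and `oH⁺ = oH`. Hence the two brackets of the mixture identity
(`bracket_same_nonneg`, `bracket_cross_nonpos`):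

  `j₁ z₀² + a₀ c₀ z₁ − z₀ a₁ c₀ − z₀ a₀ c₁ = (z₀ − a₀)(j₁ z₀ − M c₀) + a₀ (c₀ N − z₀ L) ≥ 0`

with `M = P₀(Q ∩ A ∩ D)`, `N = P₀(Q ∩ Aᶜ)`, `L = P₀(Q ∩ Aᶜ ∩ oL)` (`P₀ = P(p[g ↦ 0])`), the first factor by BHK06
Theorem 1.5 (`bhk_mixed_cluster`: `oL` against `1_A · 1_D`) and the second by BHK 1.3
(`bhk_same_cluster_events`); the cross form with `oH`, `bhk_mixed_cluster_cross` and BHK 1.4.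
-/

namespace Summit.Ventures.PercRepro2

namespace RBMarkerEdge

open scoped Classical

section Forced

variable {V : Type*} {E : Type*} [DecidableEq E] (ends : E → Sym2 V) (s t w b o : V)

omit [DecidableEq E] in
/-- `{s ↔ {b, w}}` as the cluster event of the up-set `{S | b ∈ S ∨ w ∈ S}`. -/
lemma mem_A_iff {ω : Config E} :
    ω ∈ clusterInEvent ends s {S : Set V | b ∈ S ∨ w ∈ S} ↔ Conn ends ω s b ∨ Conn ends ω s w := by
  simp only [mem_clusterInEvent, Set.mem_setOf_eq, mem_cluster]

omit [DecidableEq E] in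
/-- `{t ↮ {b, w}}` as the complement of the cluster event of `{T | b ∈ T ∨ w ∈ T}`. -/
lemma mem_D_iff {ω : Config E} :
    ω ∈ (clusterInEvent ends t {T : Set V | b ∈ T ∨ w ∈ T})ᶜ ↔
      ¬ Conn ends ω t b ∧ ¬ Conn ends ω t w := by
  simp only [Set.mem_compl_iff, mem_clusterInEvent, Set.mem_setOf_eq, mem_cluster, not_or]

omit [DecidableEq E] in
/-- `{o ↔ s}` as the cluster event of `{S | o ∈ S}`. -/
lemma clusterInEvent_mem_eq : clusterInEvent ends s {S : Set V | o ∈ S} = connEvent ends o s := by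
  ext ω
  simp only [mem_clusterInEvent, Set.mem_setOf_eq, mem_cluster, mem_connEvent]
  exact ⟨conn_symm, conn_symm⟩

omit [DecidableEq E] in
/-- The up-set `{S | x ∈ S}`. -/
lemma isUpperSet_mem (x : V) : IsUpperSet {S : Set V | x ∈ S} := fun _ _ h hS => h hS

omit [DecidableEq E] in
/-- The up-set `{S | b ∈ S ∨ w ∈ S}`. -/
lemma isUpperSet_mem_or : IsUpperSet {S : Set V | b ∈ S ∨ w ∈ S} :=
  fun _ _ h hS => hS.imp (fun hb => h hb) (fun hw => h hw)

variable {g : E} (hends : ends g = s(w, b))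
include hends

/-- Forcing `g = {w, b}` open: `Q⁺`. -/
lemma forced_Q_iff (ω : Config E) :
    Function.update ω g true ∈ (connEvent ends s t)ᶜ ↔
      ¬ Conn ends ω s t ∧ ¬ (Conn ends ω s w ∧ Conn ends ω b t) ∧
        ¬ (Conn ends ω s b ∧ Conn ends ω w t) := by
  simp only [Set.mem_compl_iff, mem_connEvent, OneEdge.conn_update_true_iff hends, not_or]

/-- Forcing `g = {w, b}` open: `bL⁺ = bL ∨ wL`. -/
lemma forced_bL_iff (ω : Config E) :
    Function.update ω g true ∈ connEvent ends b s ↔ Conn ends ω b s ∨ Conn ends ω w s := by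
  simp only [mem_connEvent, OneEdge.conn_update_true_iff hends]
  constructor
  · rintro (h | ⟨_, h⟩ | ⟨_, h⟩)
    · exact Or.inl h
    · exact Or.inl h
    · exact Or.inr h
  · rintro (h | h)
    · exact Or.inl h
    · exact Or.inr (Or.inr ⟨conn_refl _ _ _, h⟩)

/-- Forcing `g = {w, b}` open: `oL⁺`. -/
lemma forced_oL_iff (ω : Config E) :
    Function.update ω g true ∈ connEvent ends o s ↔
      Conn ends ω o s ∨ (Conn ends ω o w ∧ Conn ends ω b s) ∨ (Conn ends ω o b ∧ Conn ends ω w s) := by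
  simp only [mem_connEvent, OneEdge.conn_update_true_iff hends]

/-- Forcing `g = {w, b}` open: `oH⁺`. -/
lemma forced_oH_iff (ω : Config E) :
    Function.update ω g true ∈ connEvent ends o t ↔
      Conn ends ω o t ∨ (Conn ends ω o w ∧ Conn ends ω b t) ∨ (Conn ends ω o b ∧ Conn ends ω w t) := by
  simp only [mem_connEvent, OneEdge.conn_update_true_iff hends]

/-- **(F1)** `Q⁺ ∩ bL⁺ = Q ∩ A ∩ D`. -/
lemma forced_Q_inter_bL :
    {ω : Config E | Function.update ω g true ∈ (connEvent ends s t)ᶜ ∩ connEvent ends b s} =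
      (connEvent ends s t)ᶜ ∩ clusterInEvent ends s {S : Set V | b ∈ S ∨ w ∈ S} ∩
        (clusterInEvent ends t {T : Set V | b ∈ T ∨ w ∈ T})ᶜ := by
  ext ω
  simp only [Set.mem_setOf_eq, Set.mem_inter_iff, forced_Q_iff ends s t w b hends,
    forced_bL_iff ends s w b hends, Set.mem_compl_iff, mem_clusterInEvent,
    mem_cluster, not_or, mem_connEvent]
  constructor
  · rintro ⟨⟨hst, h1, h2⟩, hA⟩
    refine ⟨⟨hst, hA.imp conn_symm conn_symm⟩, ?_, ?_⟩
    · intro htb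
      rcases hA with hbs | hws
      · exact hst (conn_trans (conn_symm hbs) (conn_symm htb))
      · exact h1 ⟨conn_symm hws, conn_symm htb⟩
    · intro htw
      rcases hA with hbs | hws
      · exact h2 ⟨conn_symm hbs, conn_symm htw⟩
      · exact hst (conn_trans (conn_symm hws) (conn_symm htw))
  · rintro ⟨⟨hst, hA⟩, htb, htw⟩
    refine ⟨⟨hst, fun h => htb (conn_symm h.2), fun h => htw (conn_symm h.2)⟩,
      hA.imp conn_symm conn_symm⟩

/-- **(F2)** `Q⁺ ∩ (bL⁺)ᶜ = Q ∩ Aᶜ`. -/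
lemma forced_Q_inter_compl_bL :
    {ω : Config E | Function.update ω g true ∈ (connEvent ends s t)ᶜ ∩ (connEvent ends b s)ᶜ} =
      (connEvent ends s t)ᶜ ∩ (clusterInEvent ends s {S : Set V | b ∈ S ∨ w ∈ S})ᶜ := by
  ext ω
  simp only [Set.mem_setOf_eq, Set.mem_inter_iff, Set.mem_compl_iff, forced_Q_iff ends s t w b hends,
    forced_bL_iff ends s w b hends, mem_A_iff, not_or, mem_connEvent]
  constructor
  · rintro ⟨⟨hst, -, -⟩, hbs, hws⟩
    exact ⟨hst, fun h => hbs (conn_symm h), fun h => hws (conn_symm h)⟩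
  · rintro ⟨hst, hsb, hsw⟩
    exact ⟨⟨hst, fun h => hsw h.1, fun h => hsb h.1⟩, fun h => hsb (conn_symm h),
      fun h => hsw (conn_symm h)⟩

/-- **(F3)** `Q⁺ ∩ (bL⁺)ᶜ ∩ oL⁺ = Q ∩ Aᶜ ∩ oL`. -/
lemma forced_Q_compl_bL_oL :
    {ω : Config E | Function.update ω g true ∈
        (connEvent ends s t)ᶜ ∩ (connEvent ends b s)ᶜ ∩ connEvent ends o s} =
      (connEvent ends s t)ᶜ ∩ (clusterInEvent ends s {S : Set V | b ∈ S ∨ w ∈ S})ᶜ ∩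
        connEvent ends o s := by
  rw [show {ω : Config E | Function.update ω g true ∈
      (connEvent ends s t)ᶜ ∩ (connEvent ends b s)ᶜ ∩ connEvent ends o s} =
      {ω | Function.update ω g true ∈ (connEvent ends s t)ᶜ ∩ (connEvent ends b s)ᶜ} ∩
        {ω | Function.update ω g true ∈ connEvent ends o s} from rfl,
    forced_Q_inter_compl_bL ends s t w b hends]
  ext ω
  simp only [Set.mem_inter_iff, Set.mem_setOf_eq, Set.mem_compl_iff, mem_A_iff, not_or,
    mem_connEvent, forced_oL_iff ends s w b o hends]
  constructor
  · rintro ⟨⟨hst, hsb, hsw⟩, hos | ⟨-, hbs⟩ | ⟨-, hws⟩⟩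
    · exact ⟨⟨hst, hsb, hsw⟩, hos⟩
    · exact absurd (conn_symm hbs) hsb
    · exact absurd (conn_symm hws) hsw
  · rintro ⟨h, hos⟩
    exact ⟨h, Or.inl hos⟩

/-- **(F4)** `Q ∩ A ∩ D ∩ oL ⊆ Q⁺ ∩ bL⁺ ∩ oL⁺`. -/
lemma forced_Q_bL_oL_supset :
    (connEvent ends s t)ᶜ ∩ clusterInEvent ends s {S : Set V | b ∈ S ∨ w ∈ S} ∩
        (clusterInEvent ends t {T : Set V | b ∈ T ∨ w ∈ T})ᶜ ∩ connEvent ends o s ⊆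
      {ω : Config E | Function.update ω g true ∈
        (connEvent ends s t)ᶜ ∩ connEvent ends b s ∩ connEvent ends o s} := by
  intro ω ⟨h, hos⟩
  exact ⟨(Set.ext_iff.1 (forced_Q_inter_bL ends s t w b hends) ω).2 h,
    (forced_oL_iff ends s w b o hends ω).2 (Or.inl hos)⟩

/-- **(F5)** `Q⁺ ∩ bL⁺ ∩ oH⁺ = Q ∩ A ∩ D ∩ oH`. -/
lemma forced_Q_bL_oH :
    {ω : Config E | Function.update ω g true ∈
        (connEvent ends s t)ᶜ ∩ connEvent ends b s ∩ connEvent ends o t} =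
      (connEvent ends s t)ᶜ ∩ clusterInEvent ends s {S : Set V | b ∈ S ∨ w ∈ S} ∩
        (clusterInEvent ends t {T : Set V | b ∈ T ∨ w ∈ T})ᶜ ∩ connEvent ends o t := by
  rw [show {ω : Config E | Function.update ω g true ∈
      (connEvent ends s t)ᶜ ∩ connEvent ends b s ∩ connEvent ends o t} =
      {ω | Function.update ω g true ∈ (connEvent ends s t)ᶜ ∩ connEvent ends b s} ∩
        {ω | Function.update ω g true ∈ connEvent ends o t} from rfl,
    forced_Q_inter_bL ends s t w b hends]
  ext ω
  simp only [Set.mem_inter_iff, Set.mem_setOf_eq, Set.mem_compl_iff,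
    mem_clusterInEvent, mem_cluster, not_or, mem_connEvent, forced_oH_iff ends t w b o hends]
  constructor
  · rintro ⟨⟨hQA, htb, htw⟩, hot | ⟨-, hbt⟩ | ⟨-, hwt⟩⟩
    · exact ⟨⟨hQA, htb, htw⟩, hot⟩
    · exact absurd (conn_symm hbt) htb
    · exact absurd (conn_symm hwt) htw
  · rintro ⟨h, hot⟩
    exact ⟨h, Or.inl hot⟩

/-- **(F6)** `Q ∩ Aᶜ ∩ oH ⊆ Q⁺ ∩ (bL⁺)ᶜ ∩ oH⁺`. -/
lemma forced_Q_compl_bL_oH_supset :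
    (connEvent ends s t)ᶜ ∩ (clusterInEvent ends s {S : Set V | b ∈ S ∨ w ∈ S})ᶜ ∩
        connEvent ends o t ⊆
      {ω : Config E | Function.update ω g true ∈
        (connEvent ends s t)ᶜ ∩ (connEvent ends b s)ᶜ ∩ connEvent ends o t} := by
  intro ω ⟨h, hot⟩
  exact ⟨(Set.ext_iff.1 (forced_Q_inter_compl_bL ends s t w b hends) ω).2 h,
    (forced_oH_iff ends t w b o hends ω).2 (Or.inl hot)⟩

end Forced

section Bracket

variable {V : Type*} {E : Type*} [Fintype E] [DecidableEq E] [Fintype V] [DecidableEq V]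
  {R : Type*} [Field R] [LinearOrder R] [IsStrictOrderedRing R]
  (ends : E → Sym2 V) (s t w b o : V)

omit [Fintype V] [DecidableEq V] [LinearOrder R] [IsStrictOrderedRing R] in
/-- `P(p[g ↦ 1])(S) = P(p[g ↦ 0])(S⁺)`. -/
lemma prob_update_one_eq_zero_forced (p : E → R) (g : E) (S : Set (Config E)) :
    prob (Function.update p g 1) S =
      prob (Function.update p g 0) {ω | Function.update ω g true ∈ S} := by
  rw [← RBRootEdge.prob_update_one_eq (Function.update p g 0) g S, Function.update_idem]

omit [Fintype V] [DecidableEq V] [LinearOrder R] [IsStrictOrderedRing R] in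
/-- The forced set of an intersection with a complement splits the forced set. -/
lemma prob_forced_split (p : E → R) (g : E) (S T : Set (Config E)) :
    prob p {ω | Function.update ω g true ∈ S ∩ T} +
      prob p {ω | Function.update ω g true ∈ S ∩ Tᶜ} =
      prob p {ω | Function.update ω g true ∈ S} := by
  have e1 : {ω : Config E | Function.update ω g true ∈ S ∩ T} =
      {ω | Function.update ω g true ∈ S} ∩ {ω | Function.update ω g true ∈ T} := rfl
  have e2 : {ω : Config E | Function.update ω g true ∈ S ∩ Tᶜ} =
      {ω | Function.update ω g true ∈ S} ∩ {ω | Function.update ω g true ∈ T}ᶜ := rfl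
  rw [e1, e2]
  exact prob_inter_add_prob_inter_compl p _ _

/-- **The same-form bracket is nonnegative** (MINEA-MARKEREDGE §2 (iv)): for `g = {w, b}`,
`j₁ z₀² + a₀ c₀ z₁ − z₀ a₁ c₀ − z₀ a₀ c₁ ≥ 0` with `a_i = P_i(Q ∩ bL)`, `c_i = P_i(Q ∩ oL)`,
`z_i = P_i(Q)`, `j₁ = P₁(Q ∩ bL ∩ oL)`, `P_i = P(p[g ↦ i])`. -/
theorem bracket_same_nonneg (p : E → R) (hp : IsProbVec p) {g : E} (hends : ends g = s(w, b)) :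
    0 ≤ prob (Function.update p g 1) ((connEvent ends s t)ᶜ ∩ connEvent ends b s ∩ connEvent ends o s) *
          prob (Function.update p g 0) (connEvent ends s t)ᶜ ^ 2 +
        prob (Function.update p g 0) ((connEvent ends s t)ᶜ ∩ connEvent ends b s) *
          prob (Function.update p g 0) ((connEvent ends s t)ᶜ ∩ connEvent ends o s) *
          prob (Function.update p g 1) (connEvent ends s t)ᶜ -
        prob (Function.update p g 0) (connEvent ends s t)ᶜ *
          prob (Function.update p g 1) ((connEvent ends s t)ᶜ ∩ connEvent ends b s) *
          prob (Function.update p g 0) ((connEvent ends s t)ᶜ ∩ connEvent ends o s) -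
        prob (Function.update p g 0) (connEvent ends s t)ᶜ *
          prob (Function.update p g 0) ((connEvent ends s t)ᶜ ∩ connEvent ends b s) *
          prob (Function.update p g 1) ((connEvent ends s t)ᶜ ∩ connEvent ends o s) := by
  have hp0 : IsProbVec (Function.update p g 0) := hp.update g le_rfl zero_le_one
  set Q := (connEvent ends s t)ᶜ with hQ
  set bL := connEvent ends b s with hbL
  set oL := connEvent ends o s with hoL
  set A := clusterInEvent ends s {S : Set V | b ∈ S ∨ w ∈ S} with hA
  set D := (clusterInEvent ends t {T : Set V | b ∈ T ∨ w ∈ T})ᶜ with hD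
  -- the `1`-quantities as forced events under `P₀`
  rw [prob_update_one_eq_zero_forced, prob_update_one_eq_zero_forced, prob_update_one_eq_zero_forced,
    prob_update_one_eq_zero_forced]
  -- `a₁ = M`, `z₁ = M + N`, `c₁ = j₁ + L`, `j₁ ≥ J`
  have ha₁ : prob (Function.update p g 0) {ω | Function.update ω g true ∈ Q ∩ bL} = prob (Function.update p g 0) (Q ∩ A ∩ D) := by
    rw [forced_Q_inter_bL ends s t w b hends]
  have hz₁ : prob (Function.update p g 0) {ω | Function.update ω g true ∈ Q} = prob (Function.update p g 0) (Q ∩ A ∩ D) + prob (Function.update p g 0) (Q ∩ Aᶜ) := by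
    rw [← prob_forced_split _ g Q bL, forced_Q_inter_bL ends s t w b hends,
      forced_Q_inter_compl_bL ends s t w b hends]
  have hc₁ : prob (Function.update p g 0) {ω | Function.update ω g true ∈ Q ∩ oL} =
      prob (Function.update p g 0) {ω | Function.update ω g true ∈ Q ∩ bL ∩ oL} + prob (Function.update p g 0) (Q ∩ Aᶜ ∩ oL) := by
    have e : {ω : Config E | Function.update ω g true ∈ Q ∩ oL ∩ bL} =
        {ω | Function.update ω g true ∈ Q ∩ bL ∩ oL} := by
      ext ω; simp only [Set.mem_setOf_eq, Set.mem_inter_iff]; tauto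
    have e' : {ω : Config E | Function.update ω g true ∈ Q ∩ oL ∩ bLᶜ} =
        {ω | Function.update ω g true ∈ Q ∩ bLᶜ ∩ oL} := by
      ext ω; simp only [Set.mem_setOf_eq, Set.mem_inter_iff]; tauto
    rw [← prob_forced_split _ g (Q ∩ oL) bL, e, e', forced_Q_compl_bL_oL ends s t w b o hends]
  have hj₁ : prob (Function.update p g 0) (Q ∩ A ∩ D ∩ oL) ≤ prob (Function.update p g 0) {ω | Function.update ω g true ∈ Q ∩ bL ∩ oL} :=
    prob_mono hp0 (forced_Q_bL_oL_supset ends s t w b o hends)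
  -- the splits of the `0`-quantities
  have hN : prob (Function.update p g 0) (Q ∩ A) + prob (Function.update p g 0) (Q ∩ Aᶜ) = prob (Function.update p g 0) Q := prob_inter_add_prob_inter_compl _ _ _
  have hL : prob (Function.update p g 0) (Q ∩ oL ∩ A) + prob (Function.update p g 0) (Q ∩ oL ∩ Aᶜ) = prob (Function.update p g 0) (Q ∩ oL) := prob_inter_add_prob_inter_compl _ _ _
  have hL' : prob (Function.update p g 0) (Q ∩ Aᶜ ∩ oL) = prob (Function.update p g 0) (Q ∩ oL ∩ Aᶜ) := by rw [Set.inter_right_comm]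
  -- KEY (BHK06 Theorem 1.5) and BHK 1.3 on `P₀`
  have hU : IsUpperSet {S : Set V | o ∈ S} := isUpperSet_mem o
  have hV : IsUpperSet {S : Set V | b ∈ S ∨ w ∈ S} := isUpperSet_mem_or w b
  have key := BHKMixed.bhk_mixed_cluster (Function.update p g 0) hp0 ends s t hU hV hV
  have bhk := bhk_same_cluster_events (Function.update p g 0) hp0 ends s t hU hV
  rw [clusterInEvent_mem_eq] at key bhk
  rw [← BHKMixed.clusterInEvent_inter, clusterInEvent_mem_eq] at key
  -- reorder the intersections
  have e1 : oL ∩ Q = Q ∩ oL := Set.inter_comm _ _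
  have e2 : A ∩ D ∩ Q = Q ∩ A ∩ D := by ext; simp only [Set.mem_inter_iff]; tauto
  have e3 : oL ∩ A ∩ D ∩ Q = Q ∩ A ∩ D ∩ oL := by ext; simp only [Set.mem_inter_iff]; tauto
  have e4 : A ∩ Q = Q ∩ A := Set.inter_comm _ _
  have e5 : oL ∩ A ∩ Q = Q ∩ oL ∩ A := by ext; simp only [Set.mem_inter_iff]; tauto
  rw [e1, e2, e3] at key
  rw [e1, e4, e5] at bhk
  -- assemble
  have hz0 : 0 ≤ prob (Function.update p g 0) Q := prob_nonneg hp0 _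
  have ha0 : 0 ≤ prob (Function.update p g 0) (Q ∩ bL) := prob_nonneg hp0 _
  have ha0z : prob (Function.update p g 0) (Q ∩ bL) ≤ prob (Function.update p g 0) Q := prob_mono hp0 Set.inter_subset_left
  have hM0 : 0 ≤ prob (Function.update p g 0) (Q ∩ A ∩ D) := prob_nonneg hp0 _
  rw [ha₁, hz₁, hc₁]
  have hid : prob (Function.update p g 0) {ω | Function.update ω g true ∈ Q ∩ bL ∩ oL} * prob (Function.update p g 0) Q ^ 2 +
      prob (Function.update p g 0) (Q ∩ bL) * prob (Function.update p g 0) (Q ∩ oL) * (prob (Function.update p g 0) (Q ∩ A ∩ D) + prob (Function.update p g 0) (Q ∩ Aᶜ)) -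
      prob (Function.update p g 0) Q * prob (Function.update p g 0) (Q ∩ A ∩ D) * prob (Function.update p g 0) (Q ∩ oL) -
      prob (Function.update p g 0) Q * prob (Function.update p g 0) (Q ∩ bL) * (prob (Function.update p g 0) {ω | Function.update ω g true ∈ Q ∩ bL ∩ oL} + prob (Function.update p g 0) (Q ∩ Aᶜ ∩ oL)) =
      (prob (Function.update p g 0) Q - prob (Function.update p g 0) (Q ∩ bL)) * (prob (Function.update p g 0) {ω | Function.update ω g true ∈ Q ∩ bL ∩ oL} * prob (Function.update p g 0) Q -
        prob (Function.update p g 0) (Q ∩ A ∩ D) * prob (Function.update p g 0) (Q ∩ oL)) +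
      prob (Function.update p g 0) (Q ∩ bL) * (prob (Function.update p g 0) Q * prob (Function.update p g 0) (Q ∩ oL ∩ A) - prob (Function.update p g 0) (Q ∩ oL) * prob (Function.update p g 0) (Q ∩ A)) := by
    rw [hL', ← hN, ← hL]
    ring
  rw [hid]
  refine add_nonneg (mul_nonneg (sub_nonneg.2 ha0z) ?_) (mul_nonneg ha0 (by linarith [bhk]))
  linarith [key, mul_le_mul_of_nonneg_right hj₁ hz0]

/-- **The cross-form bracket is nonpositive** (MINEA-MARKEREDGE §2 (v)): for `g = {w, b}`,
`k₁ z₀² + a₀ d₀ z₁ − z₀ a₁ d₀ − z₀ a₀ d₁ ≤ 0` with `d_i = P_i(Q ∩ oH)`, `k₁ = P₁(Q ∩ bL ∩ oH)`. -/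
theorem bracket_cross_nonpos (p : E → R) (hp : IsProbVec p) {g : E} (hends : ends g = s(w, b)) :
    prob (Function.update p g 1) ((connEvent ends s t)ᶜ ∩ connEvent ends b s ∩ connEvent ends o t) *
          prob (Function.update p g 0) (connEvent ends s t)ᶜ ^ 2 +
        prob (Function.update p g 0) ((connEvent ends s t)ᶜ ∩ connEvent ends b s) *
          prob (Function.update p g 0) ((connEvent ends s t)ᶜ ∩ connEvent ends o t) *
          prob (Function.update p g 1) (connEvent ends s t)ᶜ -
        prob (Function.update p g 0) (connEvent ends s t)ᶜ *
          prob (Function.update p g 1) ((connEvent ends s t)ᶜ ∩ connEvent ends b s) *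
          prob (Function.update p g 0) ((connEvent ends s t)ᶜ ∩ connEvent ends o t) -
        prob (Function.update p g 0) (connEvent ends s t)ᶜ *
          prob (Function.update p g 0) ((connEvent ends s t)ᶜ ∩ connEvent ends b s) *
          prob (Function.update p g 1) ((connEvent ends s t)ᶜ ∩ connEvent ends o t) ≤ 0 := by
  have hp0 : IsProbVec (Function.update p g 0) := hp.update g le_rfl zero_le_one
  set Q := (connEvent ends s t)ᶜ with hQ
  set bL := connEvent ends b s with hbL
  set oH := connEvent ends o t with hoH
  set A := clusterInEvent ends s {S : Set V | b ∈ S ∨ w ∈ S} with hA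
  set D := (clusterInEvent ends t {T : Set V | b ∈ T ∨ w ∈ T})ᶜ with hD
  rw [prob_update_one_eq_zero_forced, prob_update_one_eq_zero_forced, prob_update_one_eq_zero_forced,
    prob_update_one_eq_zero_forced]
  have ha₁ : prob (Function.update p g 0) {ω | Function.update ω g true ∈ Q ∩ bL} = prob (Function.update p g 0) (Q ∩ A ∩ D) := by
    rw [forced_Q_inter_bL ends s t w b hends]
  have hz₁ : prob (Function.update p g 0) {ω | Function.update ω g true ∈ Q} = prob (Function.update p g 0) (Q ∩ A ∩ D) + prob (Function.update p g 0) (Q ∩ Aᶜ) := by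
    rw [← prob_forced_split _ g Q bL, forced_Q_inter_bL ends s t w b hends,
      forced_Q_inter_compl_bL ends s t w b hends]
  have hk₁ : prob (Function.update p g 0) {ω | Function.update ω g true ∈ Q ∩ bL ∩ oH} = prob (Function.update p g 0) (Q ∩ A ∩ D ∩ oH) := by
    rw [forced_Q_bL_oH ends s t w b o hends]
  have hd₁ : prob (Function.update p g 0) (Q ∩ A ∩ D ∩ oH) + prob (Function.update p g 0) (Q ∩ Aᶜ ∩ oH) ≤
      prob (Function.update p g 0) {ω | Function.update ω g true ∈ Q ∩ oH} := by
    rw [← prob_forced_split _ g (Q ∩ oH) bL, ← hk₁]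
    have e : {ω : Config E | Function.update ω g true ∈ Q ∩ oH ∩ bL} =
        {ω | Function.update ω g true ∈ Q ∩ bL ∩ oH} := by
      ext ω; simp only [Set.mem_setOf_eq, Set.mem_inter_iff]; tauto
    have e' : {ω : Config E | Function.update ω g true ∈ Q ∩ oH ∩ bLᶜ} =
        {ω | Function.update ω g true ∈ Q ∩ bLᶜ ∩ oH} := by
      ext ω; simp only [Set.mem_setOf_eq, Set.mem_inter_iff]; tauto
    rw [e, e']
    exact add_le_add le_rfl (prob_mono hp0 (forced_Q_compl_bL_oH_supset ends s t w b o hends))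
  have hN : prob (Function.update p g 0) (Q ∩ A) + prob (Function.update p g 0) (Q ∩ Aᶜ) = prob (Function.update p g 0) Q := prob_inter_add_prob_inter_compl _ _ _
  have hL : prob (Function.update p g 0) (Q ∩ oH ∩ A) + prob (Function.update p g 0) (Q ∩ oH ∩ Aᶜ) = prob (Function.update p g 0) (Q ∩ oH) := prob_inter_add_prob_inter_compl _ _ _
  have hL' : prob (Function.update p g 0) (Q ∩ Aᶜ ∩ oH) = prob (Function.update p g 0) (Q ∩ oH ∩ Aᶜ) := by rw [Set.inter_right_comm]
  have hU : IsUpperSet {T : Set V | o ∈ T} := isUpperSet_mem o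
  have hV : IsUpperSet {S : Set V | b ∈ S ∨ w ∈ S} := isUpperSet_mem_or w b
  have key := BHKMixed.bhk_mixed_cluster_cross (Function.update p g 0) hp0 ends s t hV hV hU
  have bhk := bhk_cross_cluster (Function.update p g 0) hp0 ends s t hV hU
  have hoH_eq : clusterInEvent ends t {T : Set V | o ∈ T} = oH := clusterInEvent_mem_eq ends t o
  rw [hoH_eq] at key bhk
  have e2 : A ∩ D ∩ Q = Q ∩ A ∩ D := by ext; simp only [Set.mem_inter_iff]; tauto
  have e3 : A ∩ D ∩ oH ∩ Q = Q ∩ A ∩ D ∩ oH := by ext; simp only [Set.mem_inter_iff]; tauto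
  have e4 : oH ∩ Q = Q ∩ oH := Set.inter_comm _ _
  have e5 : A ∩ oH ∩ Q = Q ∩ oH ∩ A := by ext; simp only [Set.mem_inter_iff]; tauto
  have e6 : A ∩ Q = Q ∩ A := Set.inter_comm _ _
  rw [e2, e3, e4] at key
  rw [e5, e4, e6] at bhk
  have hz0 : 0 ≤ prob (Function.update p g 0) Q := prob_nonneg hp0 _
  have ha0 : 0 ≤ prob (Function.update p g 0) (Q ∩ bL) := prob_nonneg hp0 _
  have ha0z : prob (Function.update p g 0) (Q ∩ bL) ≤ prob (Function.update p g 0) Q := prob_mono hp0 Set.inter_subset_left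
  rw [ha₁, hz₁, hk₁]
  have hid : prob (Function.update p g 0) (Q ∩ A ∩ D ∩ oH) * prob (Function.update p g 0) Q ^ 2 +
      prob (Function.update p g 0) (Q ∩ bL) * prob (Function.update p g 0) (Q ∩ oH) * (prob (Function.update p g 0) (Q ∩ A ∩ D) + prob (Function.update p g 0) (Q ∩ Aᶜ)) -
      prob (Function.update p g 0) Q * prob (Function.update p g 0) (Q ∩ A ∩ D) * prob (Function.update p g 0) (Q ∩ oH) -
      prob (Function.update p g 0) Q * prob (Function.update p g 0) (Q ∩ bL) * (prob (Function.update p g 0) (Q ∩ A ∩ D ∩ oH) + prob (Function.update p g 0) (Q ∩ Aᶜ ∩ oH)) =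
      (prob (Function.update p g 0) Q - prob (Function.update p g 0) (Q ∩ bL)) * (prob (Function.update p g 0) (Q ∩ A ∩ D ∩ oH) * prob (Function.update p g 0) Q - prob (Function.update p g 0) (Q ∩ A ∩ D) * prob (Function.update p g 0) (Q ∩ oH)) +
      prob (Function.update p g 0) (Q ∩ bL) * (prob (Function.update p g 0) Q * prob (Function.update p g 0) (Q ∩ oH ∩ A) - prob (Function.update p g 0) (Q ∩ oH) * prob (Function.update p g 0) (Q ∩ A)) := by
    rw [hL', ← hN, ← hL]
    ring
  have hmono : prob (Function.update p g 0) Q * prob (Function.update p g 0) (Q ∩ bL) * (prob (Function.update p g 0) (Q ∩ A ∩ D ∩ oH) + prob (Function.update p g 0) (Q ∩ Aᶜ ∩ oH)) ≤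
      prob (Function.update p g 0) Q * prob (Function.update p g 0) (Q ∩ bL) * prob (Function.update p g 0) {ω | Function.update ω g true ∈ Q ∩ oH} :=
    mul_le_mul_of_nonneg_left hd₁ (mul_nonneg hz0 ha0)
  have hbr : (prob (Function.update p g 0) Q - prob (Function.update p g 0) (Q ∩ bL)) * (prob (Function.update p g 0) (Q ∩ A ∩ D ∩ oH) * prob (Function.update p g 0) Q - prob (Function.update p g 0) (Q ∩ A ∩ D) * prob (Function.update p g 0) (Q ∩ oH)) +
      prob (Function.update p g 0) (Q ∩ bL) * (prob (Function.update p g 0) Q * prob (Function.update p g 0) (Q ∩ oH ∩ A) - prob (Function.update p g 0) (Q ∩ oH) * prob (Function.update p g 0) (Q ∩ A)) ≤ 0 :=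
    add_nonpos (mul_nonpos_of_nonneg_of_nonpos (sub_nonneg.2 ha0z) (by linarith [key]))
      (mul_nonpos_of_nonneg_of_nonpos ha0 (by linarith [bhk]))
  linarith [hid, hmono, hbr]

end Bracket

end RBMarkerEdge

end Summit.Ventures.PercRepro2
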